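import Literature.Geometry.Lorentzian.KerrDataSchwarzschildMetric
import Literature.Analysis.Calculus.SmoothCutoff
import Mathlib.Analysis.Calculus.Deriv.MeanValue
import Mathlib.Topology.Order.MonotoneContinuity
import HarnessLib

/-!
# `KerrShieldedDataExist`, line `plug-the-second-sheet` — the assembly, I: the radial profile of the
# end chart

Support file (everything proved; no definitions, no named facts) for stub `stub_assembly` of crux
`stmt-FinalStateConjecture-10055`. The end chart of the glued datum is the radial map
`φ(y) = (S(|y|)/|y|) y` of the Kerr–Schild slice `{|y| > r₁}`, whose inverse `ψ(x) = (Q(|x|)/|x|) x`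
re-reads the far part of the bent Boyer–Lindquist leaf in the sheet-one ISOTROPIC radius: `Q(ρ) = ρ`
for `ρ ≤ 4M` (no re-reading near the junction) and `Q(ρ) = ρ(1 + M/2ρ)² = (2ρ + M)²/(4ρ)` (the
isotropic→areal map, Wald 1984, §6.4, (6.4.30)–(6.4.31)) for `ρ ≥ 6M`.

* `exists_radialProfile` — a pair `(Q, S)` of smooth, strictly increasing, mutually inverse bijections
  of `ℝ` with these two properties (`Q = id + χ · (M + M²/4ρ)` with a smooth step `χ`; `S = Q⁻¹` is
  smooth by the one-variable inverse function theorem, `Q′ ≥ 63/64`);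
* `norm_radialScale`, `radialScale_radialScale`, `contDiffAt_radialScale` — the pointwise calculus of the
  radial re-scalings `y ↦ (f(|y|)/|y|) y` of `E3 ∖ {0}`.
-/

-- the doubled `FinalStateConjecture` path component is the summit/problem naming scheme, not a mistake
set_option linter.dupNamespace false

noncomputable section

open Real Set Filter Topology
open scoped ContDiff Topology
open Literature.Geometry.Lorentzian
open Literature.Analysis.Calculus (differentiable_smoothTransition)

namespace Summit.FinalStateConjecture.FinalStateConjecture.Theorems.SwallowTheDatum

namespace Assembly

/-! ### The profile `Q = id + χ · (M + M²/4ρ)` -/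

section Profile

variable {M : ℝ}

/-- The smooth step `χ(ρ) = smoothTransition(ρ/(2M) − 2)` vanishes for `ρ ≤ 4M`. [folklore] -/
theorem step_eq_zero (hM : 0 < M) {ρ : ℝ} (hρ : ρ ≤ 4 * M) :
    Real.smoothTransition ((2 * M)⁻¹ * ρ + (-2)) = 0 := by
  apply Real.smoothTransition.zero_of_nonpos
  rw [inv_mul_eq_div, ← sub_eq_add_neg, sub_nonpos, div_le_iff₀ (by positivity)]
  linarith

/-- The smooth step `χ(ρ) = smoothTransition(ρ/(2M) − 2)` equals one for `ρ ≥ 6M`. [folklore] -/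
theorem step_eq_one (hM : 0 < M) {ρ : ℝ} (hρ : 6 * M ≤ ρ) :
    Real.smoothTransition ((2 * M)⁻¹ * ρ + (-2)) = 1 := by
  apply Real.smoothTransition.one_of_one_le
  rw [inv_mul_eq_div, ← sub_eq_add_neg, le_sub_iff_add_le, le_div_iff₀ (by positivity)]
  linarith

/-- The derivative of `Q = id + χ · (M + M²/4ρ)` off the origin. [folklore] -/
theorem hasDerivAt_profile {ρ : ℝ} (hρ : ρ ≠ 0) :
    HasDerivAt (fun ρ : ℝ ↦ ρ + Real.smoothTransition ((2 * M)⁻¹ * ρ + (-2)) * (M + M ^ 2 / 4 * ρ⁻¹))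
      (1 + (deriv Real.smoothTransition ((2 * M)⁻¹ * ρ + (-2)) * (2 * M)⁻¹ * (M + M ^ 2 / 4 * ρ⁻¹) +
        Real.smoothTransition ((2 * M)⁻¹ * ρ + (-2)) * (M ^ 2 / 4 * -(ρ ^ 2)⁻¹))) ρ := by
  have hχ : HasDerivAt (fun ρ : ℝ ↦ Real.smoothTransition ((2 * M)⁻¹ * ρ + (-2)))
      (deriv Real.smoothTransition ((2 * M)⁻¹ * ρ + (-2)) * (2 * M)⁻¹) ρ := by
    have hin : HasDerivAt (fun ρ : ℝ ↦ (2 * M)⁻¹ * ρ + (-2)) ((2 * M)⁻¹) ρ := by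
      simpa using ((hasDerivAt_id' ρ).const_mul (2 * M)⁻¹).add_const (-2)
    exact (differentiable_smoothTransition _).hasDerivAt.comp ρ hin
  have hg : HasDerivAt (fun ρ : ℝ ↦ M + M ^ 2 / 4 * ρ⁻¹) (M ^ 2 / 4 * -(ρ ^ 2)⁻¹) ρ := by
    simpa using ((hasDerivAt_inv hρ).const_mul (M ^ 2 / 4)).const_add M
  exact (hasDerivAt_id' ρ).add (hχ.mul hg)

/-- On `ρ < 4M` the profile is the identity near `ρ`, hence has derivative `1`. [folklore] -/
theorem hasDerivAt_profile_of_lt (hM : 0 < M) {ρ : ℝ} (hρ : ρ < 4 * M) :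
    HasDerivAt (fun ρ : ℝ ↦ ρ + Real.smoothTransition ((2 * M)⁻¹ * ρ + (-2)) * (M + M ^ 2 / 4 * ρ⁻¹))
      1 ρ := by
  refine (hasDerivAt_id' ρ).congr_of_eventuallyEq ?_
  filter_upwards [Iio_mem_nhds hρ] with t ht
  simp only [step_eq_zero hM (le_of_lt ht), zero_mul, add_zero]

/-- **The profile has derivative at least `63/64` everywhere** (`χ′ ≥ 0`, `0 ≤ χ ≤ 1`,
`|d(M²/4ρ)/dρ| ≤ 1/64` for `ρ ≥ 4M`). [folklore] -/
theorem deriv_profile_pos (hM : 0 < M) (ρ : ℝ) :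
    63 / 64 ≤ deriv (fun ρ : ℝ ↦ ρ + Real.smoothTransition ((2 * M)⁻¹ * ρ + (-2)) * (M + M ^ 2 / 4 * ρ⁻¹)) ρ := by
  rcases lt_or_ge ρ (4 * M) with hρ | hρ
  · rw [(hasDerivAt_profile_of_lt hM hρ).deriv]; norm_num
  · have hρ0 : 0 < ρ := by linarith
    rw [(hasDerivAt_profile hρ0.ne').deriv]
    have h1 : 0 ≤ deriv Real.smoothTransition ((2 * M)⁻¹ * ρ + (-2)) :=
      Real.smoothTransition.monotone.deriv_nonneg
    have h2 : 0 ≤ Real.smoothTransition ((2 * M)⁻¹ * ρ + (-2)) := Real.smoothTransition.nonneg _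
    have h3 : Real.smoothTransition ((2 * M)⁻¹ * ρ + (-2)) ≤ 1 := Real.smoothTransition.le_one _
    have h4 : 0 < M + M ^ 2 / 4 * ρ⁻¹ := by positivity
    have h5 : M ^ 2 / 4 * (ρ ^ 2)⁻¹ ≤ 1 / 64 := by
      rw [mul_inv_le_iff₀ (by positivity)]
      nlinarith
    have h6 : 0 ≤ deriv Real.smoothTransition ((2 * M)⁻¹ * ρ + (-2)) * (2 * M)⁻¹ * (M + M ^ 2 / 4 * ρ⁻¹) := by
      positivity
    nlinarith [mul_le_mul h3 h5 (by positivity) zero_le_one]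

/-- The profile is `C^∞`. [folklore] -/
theorem contDiff_profile (hM : 0 < M) :
    ContDiff ℝ ∞ (fun ρ : ℝ ↦ ρ + Real.smoothTransition ((2 * M)⁻¹ * ρ + (-2)) * (M + M ^ 2 / 4 * ρ⁻¹)) := by
  refine contDiff_iff_contDiffAt.2 fun ρ ↦ ?_
  rcases lt_or_ge ρ (4 * M) with hρ | hρ
  · refine (contDiffAt_id : ContDiffAt ℝ ∞ (fun ρ : ℝ ↦ ρ) ρ).congr_of_eventuallyEq ?_
    filter_upwards [Iio_mem_nhds hρ] with t ht
    simp only [step_eq_zero hM (le_of_lt ht), zero_mul, add_zero, id]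
  · have hρ0 : ρ ≠ 0 := by intro h; rw [h] at hρ; linarith
    have hχ : ContDiffAt ℝ ∞ (fun ρ : ℝ ↦ Real.smoothTransition ((2 * M)⁻¹ * ρ + (-2))) ρ :=
      (Real.smoothTransition.contDiff.comp ((contDiff_const.mul contDiff_id).add contDiff_const)).contDiffAt
    have hg : ContDiffAt ℝ ∞ (fun ρ : ℝ ↦ M + M ^ 2 / 4 * ρ⁻¹) ρ :=
      contDiffAt_const.add (contDiffAt_const.mul (contDiffAt_inv ℝ hρ0))
    exact contDiffAt_id.add (hχ.mul hg)

/-- **The radial profile of the end chart and its inverse.** For `M > 0` there are smooth, strictly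
increasing, mutually inverse bijections `Q, S : ℝ → ℝ` with `Q = S = id` on `(−∞, 4M]`,
`Q(ρ) = (2ρ + M)²/(4ρ)` (the sheet-one isotropic→areal map of Schwarzschild, Wald 1984, (6.4.31))
for `ρ ≥ 6M`, and `Q(ρ) ≥ ρ`. [cite: Wald1984, §6.4] -/
theorem exists_radialProfile (hM : 0 < M) :
    ∃ Q S : ℝ → ℝ, ContDiff ℝ ∞ Q ∧ ContDiff ℝ ∞ S ∧ StrictMono Q ∧ StrictMono S ∧
      (∀ ρ, S (Q ρ) = ρ) ∧ (∀ r, Q (S r) = r) ∧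
      (∀ ρ, ρ ≤ 4 * M → Q ρ = ρ) ∧ (∀ r, r ≤ 4 * M → S r = r) ∧
      (∀ ρ, 6 * M ≤ ρ → Q ρ = (2 * ρ + M) ^ 2 / (4 * ρ)) ∧ (∀ ρ, ρ ≤ Q ρ) := by
  set Q : ℝ → ℝ := fun ρ ↦ ρ + Real.smoothTransition ((2 * M)⁻¹ * ρ + (-2)) * (M + M ^ 2 / 4 * ρ⁻¹)
    with hQ_def
  have hQs : ContDiff ℝ ∞ Q := contDiff_profile hM
  have hQd : ∀ ρ, HasDerivAt Q (deriv Q ρ) ρ := fun ρ ↦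
    ((hQs.differentiable (by simp)) ρ).hasDerivAt
  have hQ' : ∀ ρ, 0 < deriv Q ρ := fun ρ ↦ lt_of_lt_of_le (by norm_num) (deriv_profile_pos hM ρ)
  have hmono : StrictMono Q := strictMono_of_deriv_pos hQ'
  have hid : ∀ ρ, ρ ≤ 4 * M → Q ρ = ρ := fun ρ hρ ↦ by
    simp only [hQ_def, step_eq_zero hM hρ, zero_mul, add_zero]
  have hfar : ∀ ρ, 6 * M ≤ ρ → Q ρ = (2 * ρ + M) ^ 2 / (4 * ρ) := fun ρ hρ ↦ by
    have hρ0 : ρ ≠ 0 := by intro h; rw [h] at hρ; linarith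
    simp only [hQ_def, step_eq_one hM hρ, one_mul]
    field_simp
    ring
  have hge : ∀ ρ, ρ ≤ Q ρ := fun ρ ↦ by
    rcases le_or_gt ρ (4 * M) with hρ | hρ
    · rw [hid ρ hρ]
    · have h1 : 0 ≤ Real.smoothTransition ((2 * M)⁻¹ * ρ + (-2)) := Real.smoothTransition.nonneg _
      have h2 : 0 < M + M ^ 2 / 4 * ρ⁻¹ := by
        have : 0 < ρ := by linarith
        positivity
      show ρ ≤ ρ + _
      nlinarith
  have hsurj : Function.Surjective Q := by
    refine hQs.continuous.surjective (tendsto_atTop_mono hge tendsto_id) ?_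
    refine tendsto_id.congr' ?_
    filter_upwards [eventually_le_atBot (4 * M)] with ρ hρ
    exact (hid ρ hρ).symm
  set e : ℝ ≃o ℝ := hmono.orderIsoOfSurjective Q hsurj with he_def
  have he : (e : ℝ → ℝ) = Q := hmono.coe_orderIsoOfSurjective Q hsurj
  set H : ℝ ≃ₜ ℝ := e.toHomeomorph with hH_def
  have hH : (H : ℝ → ℝ) = Q := by rw [hH_def, OrderIso.coe_toHomeomorph, he]
  have hSQ : ∀ ρ, H.symm (Q ρ) = ρ := fun ρ ↦ by
    have := H.symm_apply_apply ρ
    rwa [hH] at this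
  have hQS : ∀ r, Q (H.symm r) = r := fun r ↦ by
    have := H.apply_symm_apply r
    rwa [hH] at this
  refine ⟨Q, H.symm, hQs, ?_, hmono, ?_, hSQ, hQS, hid, fun r hr ↦ ?_, hfar, hge⟩
  · refine H.contDiff_symm_deriv (f' := deriv Q) (fun ρ ↦ (hQ' ρ).ne') (fun ρ ↦ ?_) (by rw [hH]; exact hQs)
    rw [hH]
    exact hQd ρ
  · have : (H.symm : ℝ → ℝ) = e.symm := by rw [hH_def]; rfl
    rw [this]
    exact e.symm.strictMono
  · conv_lhs => rw [← hid r hr]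
    exact hSQ r

end Profile

/-! ### Radial re-scalings of `E3 ∖ {0}` -/

section RadialScale

variable {f g : ℝ → ℝ} {y : E3}

/-- `‖(f(s)/s) y‖ = f(s)` for `s = ‖y‖ > 0` and `f(s) > 0`. [folklore] -/
theorem norm_radialScale (hy : y ≠ 0) (hf : 0 < f ‖y‖) : ‖(f ‖y‖ / ‖y‖) • y‖ = f ‖y‖ := by
  have hs : ‖y‖ ≠ 0 := norm_ne_zero_iff.2 hy
  rw [norm_smul, Real.norm_of_nonneg (div_pos hf (norm_pos_iff.2 hy)).le, div_mul_cancel₀ _ hs]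

/-- A radial re-scaling is nonzero off the origin (for a positive profile). [folklore] -/
theorem radialScale_ne_zero (hy : y ≠ 0) (hf : 0 < f ‖y‖) : (f ‖y‖ / ‖y‖) • y ≠ 0 :=
  smul_ne_zero (div_pos hf (norm_pos_iff.2 hy)).ne' hy

/-- Re-scaling by `f` and then by `g` with `g(f(s)) = s` is the identity. [folklore] -/
theorem radialScale_radialScale (hy : y ≠ 0) (hf : 0 < f ‖y‖) (hgf : g (f ‖y‖) = ‖y‖) :
    (g ‖(f ‖y‖ / ‖y‖) • y‖ / ‖(f ‖y‖ / ‖y‖) • y‖) • ((f ‖y‖ / ‖y‖) • y) = y := by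
  have hs : ‖y‖ ≠ 0 := norm_ne_zero_iff.2 hy
  rw [norm_radialScale hy hf, hgf, smul_smul]
  have : ‖y‖ / f ‖y‖ * (f ‖y‖ / ‖y‖) = 1 := by field_simp
  rw [this, one_smul]

/-- A radial re-scaling with `C^∞` profile is `C^∞` off the origin. [folklore] -/
theorem contDiffAt_radialScale (hy : y ≠ 0) (hf : ContDiffAt ℝ ∞ f ‖y‖) :
    ContDiffAt ℝ ∞ (fun z : E3 ↦ (f ‖z‖ / ‖z‖) • z) y := by
  have hn : ContDiffAt ℝ ∞ (fun z : E3 ↦ ‖z‖) y := contDiffAt_norm ℝ hy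
  exact ((hf.comp y hn).div hn (norm_ne_zero_iff.2 hy)).smul contDiffAt_id

/-- A radial re-scaling whose profile is the identity below `c` is the identity near every point of
norm `< c`. [folklore] -/
theorem radialScale_eventuallyEq_id {c : ℝ} (hf : ∀ s, s ≤ c → f s = s) (hy : y ≠ 0) (hyc : ‖y‖ < c) :
    (fun z : E3 ↦ (f ‖z‖ / ‖z‖) • z) =ᶠ[𝓝 y] id := by
  have h1 : ∀ᶠ z : E3 in 𝓝 y, ‖z‖ < c := continuous_norm.continuousAt.eventually (Iio_mem_nhds hyc)
  have h2 : ∀ᶠ z : E3 in 𝓝 y, z ≠ 0 := isOpen_ne.mem_nhds hy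
  filter_upwards [h1, h2] with z hz hz0
  rw [hf _ hz.le, div_self (norm_ne_zero_iff.2 hz0), one_smul, id]

end RadialScale

end Assembly

/-- **Registered export of this file** (sub-goal `assembly_radialProfile` of stub `stub_assembly`): the radial
profile of the end chart and its inverse, `Assembly.exists_radialProfile`. [cite: Wald1984, §6.4] -/
theorem assembly_radialProfile :
    ∀ (M : ℝ), 0 < M → ∃ Q S : ℝ → ℝ, ContDiff ℝ ∞ Q ∧ ContDiff ℝ ∞ S ∧ StrictMono Q ∧ StrictMono S ∧ (∀ ρ, S (Q ρ) = ρ) ∧ (∀ r, Q (S r) = r) ∧ (∀ ρ, ρ ≤ 4 * M → Q ρ = ρ) ∧ (∀ r, r ≤ 4 * M → S r = r) ∧ (∀ ρ, 6 * M ≤ ρ → Q ρ = (2 * ρ + M) ^ 2 / (4 * ρ)) ∧ (∀ ρ, ρ ≤ Q ρ) :=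
  fun _ hM ↦ Assembly.exists_radialProfile hM

end Summit.FinalStateConjecture.FinalStateConjecture.Theorems.SwallowTheDatum

end
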